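import Mathlib.Topology.UniformSpace.HeineCantor
import Literature.Barriers.AtomisticToContinuum.NoBVEstimatesMultiDFinitePropagationEnergy
import HarnessLib

/-!
# Finite speed of propagation, symmetrizable case: the discharge
(`Rauch1986_finitePropagationSpeed_symmetrizable_holds`)

Last file of the discharge of `Rauch1986_finitePropagationSpeed_symmetrizable`
(`NoBVEstimatesMultiDFinitePropagation.lean`): for a quasilinear system (1)
`A₀(u)∂ₜu + Σ Aⱼ(u)∂ⱼu + B(u) = 0` with `B(ū) = 0` and a smooth symmetrizer `Sym` near `ū`
(`IsSymmetrizableNear`), there is a speed `c = c(S, ū)` such that every classical solution on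
`[0, T] × ℝᵈ` with data `= ū` for `‖x‖ > R` equals `ū` for `‖x‖ > R + ct`.

The proof is the one indicated in [Rendall2008, §8.3]: fix a compact ball of states
`K₀ = B̄(ū, r₀)` inside the neighbourhood where `Sym` symmetrizes; on `K₀`,
`λ‖ξ‖² ≤ ⟨ξ, Sym A₀ ξ⟩` and `|⟨ξ, Sym Aⱼ ξ⟩| ≤ α‖ξ‖²` (Racke's `a₀, a₁` [Racke2015, (3.7)]), and
the speed is `c = dα/λ` (Racke's `1/ρ = n a₁/a₀`) — it depends on `S, ū` only. Given a solution
`u` and a point `(t₁, x₁)` with `‖x₁‖ > R + ct₁`, choose `ct₁ < ρ₀ < ‖x₁‖ - R`; the claim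
`u = ū` on the shrinking balls `dist(y, x₁) < ρ₀ - cs`, `s ≤ σ`, is propagated from `σ = 0`
(data) to `σ = t₁` in steps of a uniform length `δ₂` (uniform continuity of `u` on
`[0, T] × B̄(x₁, ρ₀)` keeps `u` in `K₀` for time `δ₂` after it equals `ū`, the continuity
argument replacing Rendall's "open neighbourhood of `U`" [Rendall2008, §8.3, after (8.29)]);
each step
is the cone lemma `Literature.Analysis.FluidPDE.coneEnergy_eq_zero` [Racke2015, Thm 3.1] applied
to the energy density `e = ⟨w, Sym A₀ w⟩` and fluxes `fⱼ = ⟨w, Sym Aⱼ w⟩` of `w = u - ū`, whose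
bulk inequality and cone condition are `IsClassicalSolution.bulk_le` and
`energyFlux_cone_bound` (`NoBVEstimatesMultiDFinitePropagationEnergy.lean`).

## Main results

* `IsClassicalSolution.eq_const_of_coneStep` — one step: if `u(σ, ·) = ū` on `B̄(x₁, ρ)` and
  `u ∈ K₀` on `[σ, σ''] × B̄(x₁, ρ)`, then `u(s, y) = ū` for `σ < s ≤ σ''`,
  `dist(y, x₁) < ρ - c(s - σ)`;
* `Rauch1986_finitePropagationSpeed_symmetrizable_holds` — the discharge;
* `Rauch1986_finitePropagationSpeed_of_strictlyHyperbolic` — the original named fact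
  `Rauch1986_finitePropagationSpeed` now rests on its strictly hyperbolic case alone, stated
  here as an explicit hypothesis (finite speed for systems with `B(ū) = 0` that are strictly
  hyperbolic with `A₀` invertible near `ū`); that case is NOT a separate named fact (D-0026
  review 2026-08-15: it is the unprinted residual of the parent fact, not a printed theorem —
  the printed results are the smooth-coefficient linear theorem
  [Taylor1981, Ch. IV §4 Thm 4.5] and the `L²` theory with Lipschitz coefficients and
  Lipschitz symbolic symmetrizers [Metivier2008, Thm 7.1.3, Cor. 7.1.12] — so it stays inside
  the proof obligation of `Rauch1986_finitePropagationSpeed`);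
* `exists_hasPropagationSpeed_of_isRauchClass_of_le_one` — for `k ≤ 1` (scalar equations,
  Rauch's Example 2) the strictly hyperbolic case is symmetrizable with `Sym = A₀`, so the
  fact holds unconditionally; what remains unproved of `Rauch1986_finitePropagationSpeed`
  concerns strictly hyperbolic systems with `k ≥ 2`, `d ≥ 1` (and `d ≥ 2` after
  `NoBVEstimatesMultiDFinitePropagationOneD.lean`).

## References

* [Rendall2008] A. D. Rendall, *Partial Differential Equations in General Relativity* (2008),
  §8.3 ((8.28)–(8.29), local uniqueness, Defs. 8.1–8.2 domain of dependence / influence, finite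
  speed of propagation).
* [Racke2015] R. Racke, *Lectures on Nonlinear Evolution Equations*, 2nd ed., Ch. 3 Thm 3.1
  and the Remark after Cor. 3.2.
* [John1982] F. John, *Partial Differential Equations*, 4th ed., Ch. 5 §3.
* [Rauch1986] J. Rauch, Comm. Math. Phys. 106 (1986), Proof of Theorem p. 482.
* [Taylor1981] M. E. Taylor, *Pseudodifferential Operators* (1981), Ch. IV §4 Thm 4.3, Thm 4.5.
* [Metivier2008] G. Métivier, *Para-differential Calculus and Applications to the Cauchy
  Problem for Nonlinear Systems* (2008), §7.1: Assumptions 7.1.1–7.1.2, Thm 7.1.3, Cor. 7.1.12.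
-/

noncomputable section

open Set Filter Metric Matrix
open scoped Topology ContDiff

namespace Literature.Barriers.AtomisticToContinuum

open Literature.Analysis.FluidPDE

namespace QuasilinearSystem

variable {d k : ℕ}

/-! ### Smoothness of the energy density and fluxes as functions of the state -/

/-- The quadratic form `v ↦ ⟨v - ū, F(v)(v - ū)⟩` is smooth when the entries of `F` are.
[folklore] -/
theorem contDiff_quadForm_sub {F : (Fin k → ℝ) → Matrix (Fin k) (Fin k) ℝ}
    (hF : ∀ i j, ContDiff ℝ ∞ fun v => F v i j) (ubar : Fin k → ℝ) :
    ContDiff ℝ ∞ fun v : Fin k → ℝ => (v - ubar) ⬝ᵥ (F v *ᵥ (v - ubar)) := by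
  simp only [dotProduct, mulVec, Pi.sub_apply]
  exact ContDiff.sum fun i _ => ((contDiff_apply ℝ ℝ i).sub contDiff_const).mul
    (ContDiff.sum fun j _ => (hF i j).mul ((contDiff_apply ℝ ℝ j).sub contDiff_const))

section Regularity

variable {S : QuasilinearSystem d k} {T : ℝ} {u : ℝ → Space d → Fin k → ℝ}
  {Sym : (Fin k → ℝ) → Matrix (Fin k) (Fin k) ℝ} {ubar : Fin k → ℝ}

/-- The energy density of a classical solution is continuous on sub-slabs `[τ, τ'] × ℝᵈ` of
`[0, T] × ℝᵈ`. [folklore] -/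
theorem IsClassicalSolution.continuousOn_energyDensity (hu : S.IsClassicalSolution T u)
    (hSym : ∀ i i', ContDiff ℝ ∞ fun v => Sym v i i') {τ τ' : ℝ} (h0 : 0 ≤ τ) (hT : τ' ≤ T) :
    ContinuousOn (S.energyDensity Sym ubar (Function.uncurry u)) (Icc τ τ' ×ˢ univ) :=
  (contDiff_quadForm_sub (S.contDiff_symA0_apply hSym) ubar).continuous.comp_continuousOn
    (hu.contDiffOn.continuousOn.mono (prod_mono (Icc_subset_Icc h0 hT) subset_rfl))

/-- The fluxes of a classical solution are continuous on sub-slabs. [folklore] -/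
theorem IsClassicalSolution.continuousOn_energyFlux (hu : S.IsClassicalSolution T u)
    (hSym : ∀ i i', ContDiff ℝ ∞ fun v => Sym v i i') (l : Fin d) {τ τ' : ℝ} (h0 : 0 ≤ τ)
    (hT : τ' ≤ T) :
    ContinuousOn (S.energyFlux Sym ubar (Function.uncurry u) l) (Icc τ τ' ×ˢ univ) :=
  (contDiff_quadForm_sub (S.contDiff_symA_apply hSym l) ubar).continuous.comp_continuousOn
    (hu.contDiffOn.continuousOn.mono (prod_mono (Icc_subset_Icc h0 hT) subset_rfl))

/-- The energy density of a classical solution is `C¹` on open sub-slabs `(τ, τ') × ℝᵈ`.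
[folklore] -/
theorem IsClassicalSolution.contDiffOn_energyDensity (hu : S.IsClassicalSolution T u)
    (hSym : ∀ i i', ContDiff ℝ ∞ fun v => Sym v i i') {τ τ' : ℝ} (h0 : 0 ≤ τ) (hT : τ' ≤ T) :
    ContDiffOn ℝ 1 (S.energyDensity Sym ubar (Function.uncurry u)) (Ioo τ τ' ×ˢ univ) :=
  ((contDiff_quadForm_sub (S.contDiff_symA0_apply hSym) ubar).of_le
    (mod_cast le_top)).comp_contDiffOn
      (hu.contDiffOn.mono (prod_mono (Ioo_subset_Icc_self.trans (Icc_subset_Icc h0 hT))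
        subset_rfl))

/-- The fluxes of a classical solution are `C¹` on open sub-slabs. [folklore] -/
theorem IsClassicalSolution.contDiffOn_energyFlux (hu : S.IsClassicalSolution T u)
    (hSym : ∀ i i', ContDiff ℝ ∞ fun v => Sym v i i') (l : Fin d) {τ τ' : ℝ} (h0 : 0 ≤ τ)
    (hT : τ' ≤ T) :
    ContDiffOn ℝ 1 (S.energyFlux Sym ubar (Function.uncurry u) l) (Ioo τ τ' ×ˢ univ) :=
  ((contDiff_quadForm_sub (S.contDiff_symA_apply hSym l) ubar).of_le
    (mod_cast le_top)).comp_contDiffOn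
      (hu.contDiffOn.mono (prod_mono (Ioo_subset_Icc_self.trans (Icc_subset_Icc h0 hT))
        subset_rfl))

end Regularity

/-! ### One propagation step (the cone lemma applied to the perturbation energy) -/

section Step

variable {S : QuasilinearSystem d k} {T : ℝ} {u : ℝ → Space d → Fin k → ℝ}
  {Sym : (Fin k → ℝ) → Matrix (Fin k) (Fin k) ℝ} {ubar : Fin k → ℝ}

/-- **One step of the propagation of `u = ū`** [Rendall2008, §8.3: the energy identity (8.28)
applied to the system (8.29) for `u - ū`]. Let `u` be a classical solution, `K₀ = B̄(ū, r₀)` a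
ball of states on which `Sym A₀` is positive definite with `λ‖ξ‖² ≤ ⟨ξ, Sym A₀ ξ⟩`, the
`Sym Aⱼ` are symmetric with `|⟨ξ, Sym Aⱼ ξ⟩| ≤ α‖ξ‖²`, and `‖Sym B(v)‖ ≤ L‖v - ū‖`; let `Ĉ, Ce`
bound the derivatives of the entries of `Sym A₀(u), Sym Aⱼ(u)` and of the energy density on
`[0, T] × B̄(x₁, ρ₀)` (interior times). If on the cylinder `[σ, σ''] × B̄(x₁, ρ)` (`ρ ≤ ρ₀`) the
solution stays in `K₀` and `u(σ, ·) = ū` on `B̄(x₁, ρ)`, then `u(s, y) = ū` for `σ < s ≤ σ''`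
and `dist(y, x₁) < ρ - (dα/λ)(s - σ)`. [cite: Racke2015, Ch. 3 Thm 3.1] -/
theorem IsClassicalSolution.eq_const_of_coneStep (hu : S.IsClassicalSolution T u)
    (hSym : ∀ i i', ContDiff ℝ ∞ fun v => Sym v i i') {r₀ lam α L Ĉ Ce ρ₀ ρ σ σ'' : ℝ}
    {x₁ : Space d} (hlam : 0 < lam) (hα : 0 ≤ α) (hL0 : 0 ≤ L) (hĈ0 : 0 ≤ Ĉ)
    (hpos : ∀ v ∈ closedBall ubar r₀, (S.symA0 Sym v).PosDef)
    (hsymm : ∀ v ∈ closedBall ubar r₀, ∀ j, (S.symA Sym j v)ᵀ = S.symA Sym j v)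
    (hlamK : ∀ v ∈ closedBall ubar r₀, ∀ ξ : Fin k → ℝ,
      lam * ‖ξ‖ ^ 2 ≤ ξ ⬝ᵥ (S.symA0 Sym v *ᵥ ξ))
    (hαK : ∀ l, ∀ v ∈ closedBall ubar r₀, ∀ ξ : Fin k → ℝ,
      |ξ ⬝ᵥ (S.symA Sym l v *ᵥ ξ)| ≤ α * ‖ξ‖ ^ 2)
    (hL : ∀ v ∈ closedBall ubar r₀, ‖Sym v *ᵥ S.B v‖ ≤ L * ‖v - ubar‖)
    (hĈA0 : ∀ i j, ∀ p ∈ Icc 0 T ×ˢ closedBall x₁ ρ₀, p.1 ∈ Ioo 0 T →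
      ‖fderiv ℝ (fun q => S.symA0 Sym (Function.uncurry u q) i j) p‖ ≤ Ĉ)
    (hĈA : ∀ l i j, ∀ p ∈ Icc 0 T ×ˢ closedBall x₁ ρ₀, p.1 ∈ Ioo 0 T →
      ‖fderiv ℝ (fun q => S.symA Sym l (Function.uncurry u q) i j) p‖ ≤ Ĉ)
    (hCe : ∀ p ∈ Icc 0 T ×ˢ closedBall x₁ ρ₀, p.1 ∈ Ioo 0 T →
      ‖fderiv ℝ (S.energyDensity Sym ubar (Function.uncurry u)) p‖ ≤ Ce)
    (hσ : 0 ≤ σ) (hσT : σ'' ≤ T) (hρρ₀ : ρ ≤ ρ₀)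
    (hregion : ∀ p ∈ Icc σ σ'' ×ˢ closedBall x₁ ρ, Function.uncurry u p ∈ closedBall ubar r₀)
    (hinit : ∀ y ∈ closedBall x₁ ρ, u σ y = ubar)
    {s : ℝ} (hs : s ∈ Ioc σ σ'') {y : Space d}
    (hy : dist y x₁ < ρ - d * α / lam * (s - σ)) :
    u s y = ubar := by
  set û : ℝ × Space d → Fin k → ℝ := Function.uncurry u with hû
  set e : ℝ × Space d → ℝ := S.energyDensity Sym ubar û with he
  set f : Fin d → ℝ × Space d → ℝ := fun l => S.energyFlux Sym ubar û l with hf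
  set c : ℝ := d * α / lam with hc
  have hc0 : 0 ≤ c := by positivity
  set M : ℝ := (2 * k * L + (d + 1) * k ^ 2 * Ĉ) / lam with hM
  have hM0 : 0 ≤ M := by positivity
  -- membership bookkeeping
  have hsub_big : ∀ {p : ℝ × Space d}, p ∈ Icc σ σ'' ×ˢ closedBall x₁ ρ →
      p ∈ Icc 0 T ×ˢ closedBall x₁ ρ₀ := fun hp =>
    ⟨⟨hσ.trans hp.1.1, hp.1.2.trans hσT⟩, closedBall_subset_closedBall hρρ₀ hp.2⟩
  have hIoo_T : ∀ {r : ℝ}, r ∈ Ioo σ σ'' → r ∈ Ioo 0 T := fun hr =>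
    ⟨hσ.trans_lt hr.1, hr.2.trans_le hσT⟩
  -- the cone lemma
  have key : e (s, y) = 0 := by
    refine coneEnergy_eq_zero (τ := σ) (τ' := σ'') (ρ := ρ) (c := c) (M := M) (C := Ce)
      (x₁ := x₁) (e := e) (f := f) hc0 ?_ ?_ ?_ ?_ ?_ ?_ ?_ ?_ hs hy
    · exact hu.continuousOn_energyDensity hSym hσ hσT
    · exact hu.contDiffOn_energyDensity hSym hσ hσT
    · exact fun l => hu.contDiffOn_energyFlux hSym l hσ hσT
    · intro p hp
      exact hCe p (hsub_big ⟨Ioo_subset_Icc_self hp.1, hp.2⟩) (hIoo_T hp.1)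
    · intro p hp
      have hK := hregion p hp
      exact le_trans (by positivity) (mul_norm_sq_le_energyDensity (ubar := ubar) hlamK hK)
    · intro p hp
      have hp' : p ∈ Icc σ σ'' ×ˢ closedBall x₁ ρ := ⟨Ioo_subset_Icc_self hp.1, hp.2⟩
      have hK := hregion p hp'
      obtain ⟨r, z⟩ := p
      have hb := hu.bulk_le (Sym := Sym) (ubar := ubar) (K₀ := closedBall ubar r₀) hSym
        (fun v hv => transpose_eq_of_posDef (hpos v hv)) hsymm hL (hIoo_T hp.1) hK
        (fun i j => hĈA0 i j _ (hsub_big hp') (hIoo_T hp.1))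
        (fun l i j => hĈA l i j _ (hsub_big hp') (hIoo_T hp.1))
      have hcoer := mul_norm_sq_le_energyDensity (S := S) (Sym := Sym) (ubar := ubar) hlamK hK
      calc fderiv ℝ e (r, z) (1, 0) + ∑ j, fderiv ℝ (f j) (r, z) (0, EuclideanSpace.single j 1)
          ≤ (2 * k * L + (d + 1) * k ^ 2 * Ĉ) * ‖u r z - ubar‖ ^ 2 := hb
        _ = M * (lam * ‖u r z - ubar‖ ^ 2) := by rw [hM]; field_simp
        _ ≤ M * e (r, z) := mul_le_mul_of_nonneg_left hcoer hM0
    · intro p hp ν hν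
      have hK := hregion p hp
      have hfl := energyFlux_cone_bound (S := S) (Sym := Sym) (ubar := ubar) hαK hK ν hν
      have hcoer := mul_norm_sq_le_energyDensity (S := S) (Sym := Sym) (ubar := ubar) hlamK hK
      calc |∑ j, ν j * f j p| ≤ d * α * ‖û p - ubar‖ ^ 2 := hfl
        _ = c * (lam * ‖û p - ubar‖ ^ 2) := by rw [hc]; field_simp
        _ ≤ c * e p := mul_le_mul_of_nonneg_left hcoer hc0
    · intro z hz
      exact energyDensity_eq_zero_of_eq S Sym (hinit z hz)
  -- from `e = 0` to `u = ū`
  have hsy : ((s, y) : ℝ × Space d) ∈ Icc σ σ'' ×ˢ closedBall x₁ ρ := by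
    refine ⟨⟨hs.1.le, hs.2⟩, mem_closedBall.2 ?_⟩
    have : 0 ≤ d * α / lam * (s - σ) := mul_nonneg hc0 (sub_nonneg.2 hs.1.le)
    linarith
  have hcoer := mul_norm_sq_le_energyDensity (S := S) (Sym := Sym) (ubar := ubar) hlamK
    (hregion _ hsy)
  rw [show S.energyDensity Sym ubar û (s, y) = e (s, y) from rfl, key] at hcoer
  have hsq : ‖û (s, y) - ubar‖ ^ 2 ≤ 0 := by
    by_contra hne
    have : 0 < lam * ‖û (s, y) - ubar‖ ^ 2 := mul_pos hlam (lt_of_not_ge hne)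
    linarith
  have hzero : ‖û (s, y) - ubar‖ = 0 := by nlinarith [norm_nonneg (û (s, y) - ubar)]
  exact sub_eq_zero.1 (norm_eq_zero.1 hzero)

end Step

end QuasilinearSystem

open QuasilinearSystem

/-! ### The discharge -/

/-- **Finite speed of propagation for symmetrizable systems (discharge of
`Rauch1986_finitePropagationSpeed_symmetrizable`).** For (1) with `B(ū) = 0` and a smooth
symmetrizer on a neighbourhood of `ū`, the speed `c = dα/λ` — `λ`, `α` the coercivity and flux
constants of `Sym A₀`, `Sym Aⱼ` on a compact ball of states around `ū` [Racke2015, (3.7)] —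
bounds the domain of influence of the constant state: classical solutions with data `= ū` off
`‖x‖ ≤ R` equal `ū` off `‖x‖ ≤ R + ct` [Rendall2008, §8.3, after Def. 8.2]. Proof: the cone lemma
(`coneEnergy_eq_zero`, [Racke2015, Thm 3.1]) for the energy of `u - ū`
[Rendall2008, (8.28)–(8.29)], propagated in uniform time steps by uniform continuity of `u` on
compact cylinders. [cite: Rauch1986, Proof of Theorem p. 482] -/
theorem Rauch1986_finitePropagationSpeed_symmetrizable_holds :
    Rauch1986_finitePropagationSpeed_symmetrizable := by
  intro d k S ubar hB hS
  obtain ⟨U, hU, Sym, hSym, hgood⟩ := hS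
  obtain ⟨r₀, hr₀, hball⟩ := nhds_basis_closedBall.mem_iff.1 hU
  have hK₀ : IsCompact (closedBall ubar r₀) := isCompact_closedBall _ _
  have hpos : ∀ v ∈ closedBall ubar r₀, (S.symA0 Sym v).PosDef := fun v hv =>
    (hgood v (hball hv)).1
  have hsymm : ∀ v ∈ closedBall ubar r₀, ∀ j, (S.symA Sym j v)ᵀ = S.symA Sym j v :=
    fun v hv j => (hgood v (hball hv)).2 j
  obtain ⟨lam, hlam, hlamK⟩ :=
    exists_pos_mul_norm_sq_le_dotProduct_mulVec hK₀ (S.continuous_symA0 hSym) hpos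
  obtain ⟨α, hα, hαK⟩ := exists_abs_dotProduct_mulVec_le hK₀ (F := fun l => S.symA Sym l)
    fun l => S.continuous_symA hSym l
  refine ⟨d * α / lam, by positivity, ?_⟩
  intro T R u hu hdata t₁ ht₁ x₁ hx₁
  set c : ℝ := d * α / lam with hc
  have hc0 : 0 ≤ c := by positivity
  -- the trivial case `t₁ = 0`
  rcases eq_or_lt_of_le ht₁.1 with h0 | ht₁pos
  · subst h0
    exact hdata x₁ (by simpa using hx₁)
  have hTpos : 0 < T := ht₁pos.trans_le ht₁.2
  -- the radius `ρ₀` with `c t₁ < ρ₀ < ‖x₁‖ - R`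
  obtain ⟨ρ₀, hρ₀c, hρ₀R⟩ : ∃ ρ₀ : ℝ, c * t₁ < ρ₀ ∧ ρ₀ < ‖x₁‖ - R :=
    ⟨(c * t₁ + (‖x₁‖ - R)) / 2, by linarith, by linarith⟩
  have hρ₀pos : 0 < ρ₀ := lt_of_le_of_lt (by positivity) hρ₀c
  -- solution-dependent constants: Lipschitz bound of `Sym B`
  obtain ⟨L, hL0, hL⟩ : ∃ L : ℝ, 0 ≤ L ∧ ∀ v ∈ closedBall ubar r₀,
      ‖Sym v *ᵥ S.B v‖ ≤ L * ‖v - ubar‖ :=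
    exists_norm_le_mul_norm_sub ((S.contDiff_sym_mulVec_B hSym).of_le (mod_cast le_top))
      (by simp [hB]) hr₀.le
  -- derivative bounds on the compact cylinder `[0, T] × B̄(x₁, ρ₀)`
  set Kbig : Set (ℝ × Space d) := Icc 0 T ×ˢ closedBall x₁ ρ₀ with hKbig
  have hKbig_cpt : IsCompact Kbig := isCompact_Icc.prod (isCompact_closedBall _ _)
  have hKbig_sub : Kbig ⊆ Icc 0 T ×ˢ univ := prod_mono subset_rfl (subset_univ _)
  set û : ℝ × Space d → Fin k → ℝ := Function.uncurry u with hû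
  have hentry0 : ∀ i j, ∃ C : ℝ, 0 ≤ C ∧ ∀ p ∈ Kbig, p.1 ∈ Ioo 0 T →
      ‖fderiv ℝ (fun q => S.symA0 Sym (û q) i j) p‖ ≤ C := fun i j =>
    exists_norm_fderiv_le_of_contDiffOn_slab hTpos
      (((S.contDiff_symA0_apply hSym i j).of_le (mod_cast le_top)).comp_contDiffOn
        hu.contDiffOn) hKbig_cpt hKbig_sub
  have hentry : ∀ l i j, ∃ C : ℝ, 0 ≤ C ∧ ∀ p ∈ Kbig, p.1 ∈ Ioo 0 T →
      ‖fderiv ℝ (fun q => S.symA Sym l (û q) i j) p‖ ≤ C := fun l i j =>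
    exists_norm_fderiv_le_of_contDiffOn_slab hTpos
      (((S.contDiff_symA_apply hSym l i j).of_le (mod_cast le_top)).comp_contDiffOn
        hu.contDiffOn) hKbig_cpt hKbig_sub
  choose C0 hC0nn hC0 using hentry0
  choose C hCnn hC using hentry
  set Ĉ : ℝ := ∑ i, ∑ j, (C0 i j + ∑ l, C l i j) with hĈ
  have hterm_nn : ∀ i j, 0 ≤ C0 i j + ∑ l, C l i j := fun i j =>
    add_nonneg (hC0nn i j) (Finset.sum_nonneg fun l _ => hCnn l i j)
  have hĈ0 : 0 ≤ Ĉ := Finset.sum_nonneg fun i _ => Finset.sum_nonneg fun j _ => hterm_nn i j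
  have hle_Ĉ : ∀ i j, C0 i j + ∑ l, C l i j ≤ Ĉ := fun i j =>
    (Finset.single_le_sum (fun j' _ => hterm_nn i j') (Finset.mem_univ j)).trans
      (Finset.single_le_sum (fun i' _ => Finset.sum_nonneg fun j' _ => hterm_nn i' j')
        (Finset.mem_univ i))
  have hĈA0 : ∀ i j, ∀ p ∈ Kbig, p.1 ∈ Ioo 0 T →
      ‖fderiv ℝ (fun q => S.symA0 Sym (û q) i j) p‖ ≤ Ĉ := fun i j p hp hp1 =>
    (hC0 i j p hp hp1).trans ((le_add_of_nonneg_right (Finset.sum_nonneg fun l _ =>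
      hCnn l i j)).trans (hle_Ĉ i j))
  have hĈA : ∀ l i j, ∀ p ∈ Kbig, p.1 ∈ Ioo 0 T →
      ‖fderiv ℝ (fun q => S.symA Sym l (û q) i j) p‖ ≤ Ĉ := fun l i j p hp hp1 =>
    (hC l i j p hp hp1).trans (((Finset.single_le_sum (fun l' _ => hCnn l' i j)
      (Finset.mem_univ l)).trans (le_add_of_nonneg_left (hC0nn i j))).trans (hle_Ĉ i j))
  obtain ⟨Ce, -, hCe⟩ : ∃ Ce : ℝ, 0 ≤ Ce ∧ ∀ p ∈ Kbig, p.1 ∈ Ioo 0 T →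
      ‖fderiv ℝ (S.energyDensity Sym ubar û) p‖ ≤ Ce :=
    exists_norm_fderiv_le_of_contDiffOn_slab hTpos
      (((contDiff_quadForm_sub (S.contDiff_symA0_apply hSym) ubar).of_le
        (mod_cast le_top)).comp_contDiffOn hu.contDiffOn) hKbig_cpt hKbig_sub
  -- uniform continuity of `u` on the cylinder
  obtain ⟨δ, hδ, hUC⟩ := Metric.uniformContinuousOn_iff.1
    (hKbig_cpt.uniformContinuousOn_of_continuous (hu.contDiffOn.continuousOn.mono hKbig_sub))
    r₀ hr₀
  set δ₂ : ℝ := δ / 2 with hδ₂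
  have hδ₂ : 0 < δ₂ := by positivity
  -- the propagated property
  set Good : ℝ → Prop := fun σ => ∀ s ∈ Icc 0 σ, ∀ y : Space d,
    dist y x₁ < ρ₀ - c * s → u s y = ubar with hGood
  have hGood_mono : ∀ {σ σ' : ℝ}, Good σ → σ' ≤ σ → Good σ' := fun h hle s hs y hy =>
    h s ⟨hs.1, hs.2.trans hle⟩ y hy
  have hGood0 : Good 0 := by
    intro s hs y hy
    have hs0 : s = 0 := le_antisymm hs.2 hs.1
    subst hs0
    refine hdata y ?_
    have h1 : ‖x₁‖ ≤ ‖y‖ + dist y x₁ := by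
      rw [dist_eq_norm]
      exact (norm_le_norm_add_norm_sub' x₁ y).trans (by rw [norm_sub_rev])
    have : dist y x₁ < ρ₀ := by simpa using hy
    linarith
  -- the step
  have hstep : ∀ {σ : ℝ}, 0 ≤ σ → σ ≤ t₁ → Good σ → Good (min (σ + δ₂) t₁) := by
    intro σ hσ0 hσt hG s hs y hy
    rcases le_or_gt s σ with hsσ | hsσ
    · exact hG s ⟨hs.1, hsσ⟩ y hy
    set σ'' : ℝ := min (σ + δ₂) t₁ with hσ''
    set ρ : ℝ := ρ₀ - c * σ with hρ
    have hρpos : 0 < ρ := by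
      have : c * σ ≤ c * t₁ := mul_le_mul_of_nonneg_left hσt hc0
      linarith
    have hρρ₀ : ρ ≤ ρ₀ := by
      have : 0 ≤ c * σ := mul_nonneg hc0 hσ0
      linarith
    have hσ''T : σ'' ≤ T := (min_le_right _ _).trans ht₁.2
    -- `u(σ, ·) = ū` on the closed ball (closure of the open ball)
    have hinitσ : ∀ z ∈ closedBall x₁ ρ, u σ z = ubar := by
      have hclosed : IsClosed {z : Space d | u σ z = ubar} :=
        isClosed_eq (hu.contDiff_slice ⟨hσ0, hσt.trans ht₁.2⟩).continuous continuous_const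
      have hballsub : ball x₁ ρ ⊆ {z : Space d | u σ z = ubar} := fun z hz =>
        hG σ ⟨hσ0, le_rfl⟩ z (by rw [hρ] at hz; exact mem_ball.1 hz)
      have := (closure_minimal hballsub hclosed)
      rw [closure_ball x₁ hρpos.ne'] at this
      exact fun z hz => this hz
    -- the solution stays in `K₀` on `[σ, σ''] × B̄(x₁, ρ)`
    have hregion : ∀ p ∈ Icc σ σ'' ×ˢ closedBall x₁ ρ, û p ∈ closedBall ubar r₀ := by
      rintro ⟨r, z⟩ ⟨hr, hz⟩
      have hzbig : z ∈ closedBall x₁ ρ₀ := closedBall_subset_closedBall hρρ₀ hz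
      have hrT : r ∈ Icc 0 T := ⟨hσ0.trans hr.1, hr.2.trans hσ''T⟩
      have hσT : σ ∈ Icc 0 T := ⟨hσ0, hσt.trans ht₁.2⟩
      have hdist : dist ((r, z) : ℝ × Space d) (σ, z) < δ := by
        rw [Prod.dist_eq, dist_self, max_eq_left dist_nonneg, Real.dist_eq, abs_of_nonneg
          (sub_nonneg.2 hr.1)]
        have : r ≤ σ + δ₂ := hr.2.trans (min_le_left _ _)
        linarith
      have huc := hUC (r, z) ⟨hrT, hzbig⟩ (σ, z) ⟨hσT, hzbig⟩ hdist
      rw [mem_closedBall]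
      have hσz : Function.uncurry u (σ, z) = ubar := hinitσ z hz
      rw [hσz] at huc
      exact huc.le
    exact hu.eq_const_of_coneStep hSym hlam hα hL0 hĈ0 hpos hsymm hlamK hαK hL hĈA0 hĈA hCe
      hσ0 hσ''T hρρ₀ hregion hinitσ ⟨hsσ, hs.2⟩ (by rw [hρ]; linarith)
  -- induction over the steps
  have hiter : ∀ n : ℕ, Good (min (n * δ₂) t₁) := by
    intro n
    induction n with
    | zero =>
      have h0 : min (((0 : ℕ) : ℝ) * δ₂) t₁ = 0 := by
        rw [Nat.cast_zero, zero_mul, min_eq_left ht₁pos.le]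
      rw [h0]
      exact hGood0
    | succ n ih =>
      have hσ0 : 0 ≤ min ((n : ℝ) * δ₂) t₁ := le_min (by positivity) ht₁pos.le
      have h := hstep hσ0 (min_le_right _ _) ih
      refine hGood_mono h (le_min ?_ (min_le_right _ _))
      rcases le_total ((n : ℝ) * δ₂) t₁ with hle | hle
      · rw [min_eq_left hle]
        push_cast
        exact (min_le_left _ _).trans (by linarith)
      · rw [min_eq_right hle]
        exact (min_le_right _ _).trans (by linarith)
  obtain ⟨n, hn⟩ := exists_nat_ge (t₁ / δ₂)
  have ht₁n : t₁ ≤ n * δ₂ := by rwa [div_le_iff₀ hδ₂] at hn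
  have hGt : Good t₁ := by simpa [min_eq_right ht₁n] using hiter n
  exact hGt t₁ ⟨ht₁.1, le_rfl⟩ x₁ (by simp; linarith)

/-- **`Rauch1986_finitePropagationSpeed` from its strictly hyperbolic case alone**: the
symmetrizable case being discharged, the original named fact holds as soon as finite speed of
propagation holds for the systems (1) with `B(ū) = 0` that are strictly hyperbolic with `A₀`
invertible near `ū` (the second alternative of `IsRauchClass.hyperbolic`) — the hypothesis `h`,
which is the remaining proof obligation of the fact and not a named fact of its own (for
strictly hyperbolic operators the printed proofs use symbolic symmetrizers
[Taylor1981, Ch. IV §4 Thm 4.5], [Metivier2008, Thm 7.1.3]).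
[cite: Rauch1986, Proof of Theorem p. 482] -/
theorem Rauch1986_finitePropagationSpeed_of_strictlyHyperbolic
    (h : ∀ ⦃d k : ℕ⦄ (S : QuasilinearSystem d k) (ubar : Fin k → ℝ), S.B ubar = 0 →
      S.IsStrictlyHyperbolicNear ubar → ∃ c : ℝ, 0 ≤ c ∧ S.HasPropagationSpeed ubar c) :
    Rauch1986_finitePropagationSpeed :=
  Rauch1986_finitePropagationSpeed_of_cases Rauch1986_finitePropagationSpeed_symmetrizable_holds h

/-- **Symmetric hyperbolic systems** (`A₀(u)` symmetric positive definite and the `Aⱼ(u)`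
symmetric at every state, `B(ū) = 0` — e.g. the compressible Euler equations in entropy
variables): finite speed of propagation of the constant state holds unconditionally
(symmetrizer `Sym = 1`). [cite: Rendall2008, §8.3 Defs. 8.1–8.2] -/
theorem hasPropagationSpeed_of_symmetric {d k : ℕ} (S : QuasilinearSystem d k)
    {ubar : Fin k → ℝ} (hB : S.B ubar = 0) (h : ∀ u, (S.A0 u).PosDef ∧ ∀ j, (S.A j u).IsSymm) :
    ∃ c : ℝ, 0 ≤ c ∧ S.HasPropagationSpeed ubar c :=
  Rauch1986_finitePropagationSpeed_symmetrizable_holds S ubar hB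
    ⟨univ, univ_mem, fun _ => 1, fun _ _ => contDiff_const, fun u _ => by simpa using h u⟩

/-! ### Scalar equations: the strictly hyperbolic case for `k ≤ 1` is symmetrizable -/

/-- For a single equation (`k = 1`) strict hyperbolicity with `A₀ ≠ 0` near `ū` makes the system
symmetrizable there, with the smooth symmetrizer `Sym = A₀` (`A₀A₀ = A₀² > 0`, and `1 × 1`
matrices are symmetric) — Rauch's Example 2 ("`k = 1`. Here (3) is trivially satisfied").
[cite: Rauch1986, Example 2 p. 482] -/
theorem QuasilinearSystem.IsStrictlyHyperbolicNear.isSymmetrizableNear_one {d : ℕ}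
    {S : QuasilinearSystem d 1} {ubar : Fin 1 → ℝ} (h : S.IsStrictlyHyperbolicNear ubar) :
    S.IsSymmetrizableNear ubar := by
  obtain ⟨U, hU, hU'⟩ := h
  refine ⟨U, hU, fun v => S.A0 v, fun i i' => S.contDiff_A0 i i', fun v hv => ⟨?_, fun j => ?_⟩⟩
  · have h00 : S.A0 v 0 0 ≠ 0 := by
      have hdet := (hU' v hv).1
      rwa [Matrix.det_fin_one] at hdet
    refine Matrix.PosDef.of_dotProduct_mulVec_pos ?_ fun x hx => ?_
    · show (S.A0 v * S.A0 v)ᴴ = S.A0 v * S.A0 v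
      rw [conjTranspose_eq_transpose_of_trivial]
      ext i j
      fin_cases i; fin_cases j
      rfl
    · have hx0 : x 0 ≠ 0 := fun h0 => hx (funext fun i => by fin_cases i; simpa using h0)
      have hpos : 0 < (S.A0 v 0 0 * x 0) ^ 2 := by positivity
      simp only [star_trivial, dotProduct, mulVec, Matrix.mul_apply, Fin.sum_univ_one]
      nlinarith [hpos]
  · show (S.A0 v * S.A j v)ᵀ = S.A0 v * S.A j v
    ext i j'
    fin_cases i; fin_cases j'
    rfl

/-- Hence finite speed of propagation holds unconditionally for strictly hyperbolic scalar
equations (`k = 1`). [cite: Rauch1986, Example 2 p. 482] -/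
theorem hasPropagationSpeed_of_isStrictlyHyperbolicNear_one {d : ℕ} (S : QuasilinearSystem d 1)
    {ubar : Fin 1 → ℝ} (hB : S.B ubar = 0) (h : S.IsStrictlyHyperbolicNear ubar) :
    ∃ c : ℝ, 0 ≤ c ∧ S.HasPropagationSpeed ubar c :=
  Rauch1986_finitePropagationSpeed_symmetrizable_holds S ubar hB h.isSymmetrizableNear_one

/-- For `k = 0` (no unknowns) every field is the constant state. [folklore] -/
theorem hasPropagationSpeed_of_zero {d : ℕ} (S : QuasilinearSystem d 0) (ubar : Fin 0 → ℝ) :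
    S.HasPropagationSpeed ubar 0 :=
  fun _ _ _ _ _ _ _ _ _ => Subsingleton.elim _ _

/-- **Rauch's fact `Rauch1986_finitePropagationSpeed` holds unconditionally for `k ≤ 1`**
(scalar equations in any dimension, Rauch's Example 2): both alternatives of the class are then
symmetrizable. What remains a named fact is the strictly hyperbolic, non-symmetrizable case,
`k ≥ 2`, `d ≥ 1`. [cite: Rauch1986, Example 2 and Proof of Theorem p. 482] -/
theorem exists_hasPropagationSpeed_of_isRauchClass_of_le_one {d k : ℕ} (hk : k ≤ 1)
    (S : QuasilinearSystem d k) (ubar : Fin k → ℝ) (hS : S.IsRauchClass ubar) :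
    ∃ c : ℝ, 0 ≤ c ∧ S.HasPropagationSpeed ubar c := by
  rcases Nat.le_one_iff_eq_zero_or_eq_one.1 hk with rfl | rfl
  · exact ⟨0, le_rfl, hasPropagationSpeed_of_zero S ubar⟩
  · rcases hS.symmetrizableNear_or with h | h
    · exact Rauch1986_finitePropagationSpeed_symmetrizable_holds S ubar hS.B_eq_zero h
    · exact hasPropagationSpeed_of_isStrictlyHyperbolicNear_one S hS.B_eq_zero h

end Literature.Barriers.AtomisticToContinuum

end
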